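import Summits.ResolutionOfSingularities.ResolutionOfSingularities.Theorems.MarkedTransferCampaignW11PnegaGr
import Literature.AlgebraicGeometry.Hironaka2017.S06BaseHike.R010aThm63
import Literature.AlgebraicGeometry.Resolution.HasseSchmidtCoefficients
import Mathlib.Algebra.CharP.Lemmas
import Mathlib.RingTheory.MvPolynomial.Basic
import Mathlib.RingTheory.MvPolynomial.Ideal
import Mathlib.Data.ZMod.Basic
import Mathlib.RingTheory.Ideal.Maps
import HarnessLib

/-!
# [OURS · L1 W1.1] Kill test K1.1 on `Campaign.pnegaGrLit`: the associated-graded negative part VANISHES at the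
# R04 witness `E = (y² + xw², 2)`, `p = 2`, x-chart — Eq. (59) read through it is `0 = 0` (seat res-L1-k11)

LADDER-RESOLUTION rung L (rescue), cell `res-hironaka`, RESCUE-SEED slot W1.1 («GRADED READING» of `℘nega`), kill
test K1.1 («Eq. (59) for (y² + xw², 2), p = 2, x-chart, under `PnegaGr` — one Lean computation»; pre-registration
HOME/STATUS.md 2026-08-26T18:49:23Z, copy HOME/L/res-L1-k11/PREREG-K1.1.md; report HOME/L/res-L1-k11/KILL-TEST-K1.1.md).
The object is `Campaign.pnegaGrLit` of `MarkedTransferCampaignW11PnegaGr.lean` (res-L1-type-o2, p463885) = K1.1's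
registered reading verbatim: the image of `℘nega(E,−a)` (row 008 `S05NegativePart.pNega K P m a`) in
`A ⧸ ℘̃(E,−(a−1))`. Helper filed `--supports stmt-ResolutionOfSingularities-15522` (host of the G1 OURS files, plan/
SIZED-ASK-L.md §4 S-s11); proofs only, no new objects.

HONEST FRAMING. Nothing here is a statement of H. Hironaka's manuscript *Resolution of singularities in positive
characteristics* (2017-03-23, [Hironaka2017], lit key `paper:url-3343fd9e678b`, PDF page = printed page); its
Def 5.1 / Eq. (36) (p.25 l.31–44), Th 6.3 / Eq. (46) (p.30 l.26–32) and Th 7.8 / Eq. (59) (p.37 l.4–20) are CANDIDATES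
[claim: Hironaka2017, status: under-review] consumed ONLY through the typed carriers `S05NegativePart.{pPosi, DD,
pTildeNeg, pNega}` (row 008), `S06BaseHike.{Eq46, Thm6_3_1}` (row 010) and explicit HYPOTHESES on an abstract family
`P : ℕ → Ideal A` standing for `j ↦ ℘(E,j)`: (П1) `g ∈ P 2` (Th 4.1 (1) p.17 l.22 «`J ⊂ ℘(E,b)`»), (П2)
`P i * P j ≤ P (i+j)` (Th 4.1, graded `O`-subalgebra), (П3) `P j ≤ 𝔪^j` (p.18 l.23 «`℘(E,d) ⊂ max(O_ξ)^d`» at a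
point of `Sing(E)`), and Th 4.5 / Th 6.3 as hypotheses where named. No verdict on GAP-LEDGER rows R01/R04/R08 is
implied (res-adj-1's M1–M7); kernel facts about typed readings only. AI computation is weaker than expert review;
nothing here is progress on resolution of singularities in positive characteristic.

RING-LEVEL MODEL. `𝔽₂ = ZMod 2`; `𝔽₂[X₀,X₁,X₂]` = `MvPolynomial (Fin 3) (ZMod 2)` with `X 0 = y₁`, `X 1 = x`,
`X 2 = w₁` the coordinates of the x-chart `(x,y,w) = (x, x·y₁, x·w₁)` of the blow-up of `𝔸³` at the origin
`ξ`; `g′ = y₁² + x·w₁²` (`g∘π = x²·g′`, `xChart_g`), of the same shape as `g = y² + x·w²`, so every statement below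
about `(E′, ξ′)` is, in the letters `y, x, w`, the same statement about `(E, ξ)` (and `Inv_{ξ′}(E′) = Inv_ξ(E)` for
any isomorphism-invariant datum). Localising at `ξ′` changes neither «`= ⊤`» nor «`⊆ (x^a) ≠ ⊤`». `m = b = 2`.

CONTENTS (all `[folklore]`; sorry-free): §1 `grImage_eq_bot_iff`, `pnegaGrLit_eq_bot_of_eq_top`,
`pTildeNeg_eq_top_of_isUnit_nat`, `gr_neg_eq_bot_of_units` (BARRIER CANDIDATE of the prereg, kernel form: unit values
of operators of order `≤ d·m` on elements of `℘(E,d·m)` for every `a ≤ d·m` ⇒ all `℘nega(E,−a) = (1)` and every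
`pnegaGrLit … a = ⊥`, `a ≥ 1` — «a filtration by ideals with `1` in degree `0` has no negative graded part»);
§2 the witness: `g_pow_two_pow`, `hasseDeriv_g_pow` (the lever's unit `∂_{y₁}^{(2^{k+1})}(g′^{2^k}) = 1`),
`pNega_witness_eq_top` (`℘nega(E′,−a)_{ξ′} = (1)` for EVERY `a ≥ 0`), `pnegaGrLit_witness_eq_bot` (all negative
graded pieces `= ⊥`), `pnegaGrLit_witness_zero_ne_bot` (the degree-`0` piece holds the class of `1`, given (П3)),
`xChart_g`, `rhs59_ne_top` / `lhs59_ne_rhs59` (literal sides of (59): `(1)` vs an ideal inside `(x^a)`),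
`graded59` (both graded sides `= ⊥`), `knockout_grImage_eq_bot` (R08 side: every element, e.g. the knock-out
`h = x·w₁²`, has class `0` in every negative degree), `K11_summary`; §3 a Diff-free second route through the typed
criterion (46): `Eq46_of_nonneg`, `pTilde_eq_top_of_Thm6_3_1`, `gr_neg_eq_bot_of_Thm6_3_1`.
-/

noncomputable section

open MvPolynomial
open Literature.AlgebraicGeometry.Resolution
open Literature.AlgebraicGeometry.Hironaka2017.S05NegativePart

set_option linter.dupNamespace false -- mandated namespace of this single-conjunct summit

namespace Summit.ResolutionOfSingularities.ResolutionOfSingularities.Theorems.Campaign.K11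

universe u v

/-! ## 1. The graded reading over the typed carrier (any commutative `K`-algebra) -/

section GradedReading

variable (K : Type u) {A : Type v} [CommRing K] [CommRing A] [Algebra K A]

/-- The graded image of an ideal `I` in degree `−a` (its image in `A ⧸ ℘̃(E,−(a−1))`) vanishes iff `I` lies in
the lower filtration piece. `Campaign.pnegaGrLit K P m a` is the case `I = ℘nega(E,−a)`. [folklore] -/
theorem grImage_eq_bot_iff (P : ℕ → Ideal A) (m a : ℕ) (I : Ideal A) :
    Submodule.map (pTildeNeg K P m ((a : ℤ) - 1)).mkQ I = ⊥ ↔ I ≤ pTildeNeg K P m ((a : ℤ) - 1) := by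
  rw [← LinearMap.le_ker_iff_map, Submodule.ker_mkQ]

/-- If `℘̃(E,−(a−1)) = (1)`, EVERY ideal placed in degree `−a` has graded image `0`; in particular
`Campaign.pnegaGrLit K P m a = ⊥`. [folklore] -/
theorem grImage_eq_bot_of_eq_top {P : ℕ → Ideal A} {m a : ℕ} (h : pTildeNeg K P m ((a : ℤ) - 1) = ⊤)
    (I : Ideal A) : Submodule.map (pTildeNeg K P m ((a : ℤ) - 1)).mkQ I = ⊥ := by
  rw [grImage_eq_bot_iff, h]; exact le_top

/-- `Campaign.pnegaGrLit K P m a = ⊥` as soon as `℘̃(E,−(a−1)) = (1)`. [folklore] -/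
theorem pnegaGrLit_eq_bot_of_eq_top {P : ℕ → Ideal A} {m a : ℕ} (h : pTildeNeg K P m ((a : ℤ) - 1) = ⊤) :
    Campaign.pnegaGrLit K P m a = ⊥ :=
  grImage_eq_bot_of_eq_top K h _

/-- For `j ≠ 0`, `℘posi(E,j) = ℘(E,j)`. [folklore] -/
theorem pPosi_of_ne_zero (P : ℕ → Ideal A) {j : ℕ} (hj : j ≠ 0) : pPosi P j = P j := by
  simp [pPosi, hj]

/-- **Unit criterion over the typed carrier.** If `0 ≤ a ≤ d·m ≠ 0` and an operator `D` of `A/K` of order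
`≤ k ≤ d·m` (EGA IV₄ 16.8.8, `Resolution.IsDiffOpLE`) takes some `f ∈ ℘(E,d·m)` to a UNIT, then
`℘̃(E,−a) = pTildeNeg K P m a = (1)` (the summand `D(m,a,d)` of Eq. (36) contains `D f`; cf. the R01 team's
HOME/ledger/evidence/R01/R01_CarrierUnitLemmas_res-type-008.lean). [folklore] -/
theorem pTildeNeg_eq_top_of_isUnit_nat (P : ℕ → Ideal A) (m : ℕ) {a : ℤ} (ha : 0 ≤ a) (d : ℕ)
    (had : a ≤ (d * m : ℕ)) (hdm : d * m ≠ 0) {k : ℕ} (hk : k ≤ d * m) {D : A →ₗ[K] A}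
    (hD : IsDiffOpLE K k D) {f : A} (hf : f ∈ P (d * m)) (hu : IsUnit (D f)) :
    pTildeNeg K P m a = ⊤ := by
  obtain ⟨n, rfl⟩ := Int.eq_ofNat_of_zero_le ha
  have hn : n ≤ d * m := by exact_mod_cast had
  have hrange : |((n : ℕ) : ℤ)| ≤ (d : ℤ) * (m : ℕ) := by
    rw [Nat.abs_cast]; exact_mod_cast hn
  apply top_le_iff.mp
  refine le_trans ?_ (le_iSup₂ (f := fun (d' : ℤ) (_ : |((n : ℕ) : ℤ)| ≤ d' * (m : ℕ)) =>
    DD K P m (n : ℤ) d') (d : ℤ) hrange)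
  show ⊤ ≤ DD K P m (n : ℤ) (d : ℤ)
  have h1 : ((d : ℤ) * (m : ℕ) + (n : ℕ)).toNat = d * m + n := by
    rw [show ((d : ℤ) * (m : ℕ) + (n : ℕ)) = ((d * m + n : ℕ) : ℤ) by push_cast; ring]
    exact Int.toNat_natCast _
  have h2 : ((d : ℤ) * (m : ℕ)).toNat = d * m := by
    rw [show ((d : ℤ) * (m : ℕ)) = ((d * m : ℕ) : ℤ) by push_cast; ring]
    exact Int.toNat_natCast _
  rw [DD, h1, h2, pPosi_of_ne_zero P hdm]
  exact top_le_iff.mpr (Ideal.eq_top_of_isUnit_mem _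
    (apply_mem_diffIdeal K (hD.of_le (hk.trans (Nat.le_add_right _ _))) hf) hu)

/-- `℘nega(E,−a)`, `a : ℕ`, form of the unit criterion. [folklore] -/
theorem pNega_eq_top_of_isUnit_nat (P : ℕ → Ideal A) (m a d : ℕ) (had : a ≤ d * m)
    (hdm : d * m ≠ 0) {k : ℕ} (hk : k ≤ d * m) {D : A →ₗ[K] A} (hD : IsDiffOpLE K k D) {f : A}
    (hf : f ∈ P (d * m)) (hu : IsUnit (D f)) : pNega K P m a = ⊤ :=
  pTildeNeg_eq_top_of_isUnit_nat K P m (Int.natCast_nonneg a) d (by exact_mod_cast had) hdm hk hD hf hu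

/-- **BARRIER CANDIDATE (prereg K1.1), kernel form.** If for every `a ≥ 0` some `d` with `a ≤ d·m ≠ 0` carries a
unit value of an operator of order `≤ d·m` on an element of `℘(E,d·m)` (the (37)-mechanism), then ALL
`℘nega(E,−a)` are `(1)` and EVERY associated-graded piece `Campaign.pnegaGrLit K P m a`, `a ≥ 1`, is `⊥`: a
filtration by ideals whose degree-`0` term contains `1` has no negative graded part. [folklore] -/
theorem gr_neg_eq_bot_of_units (P : ℕ → Ideal A) (m : ℕ)
    (hunit : ∀ a : ℕ, ∃ d k : ℕ, ∃ D : A →ₗ[K] A, ∃ f : A, a ≤ d * m ∧ d * m ≠ 0 ∧ k ≤ d * m ∧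
      IsDiffOpLE K k D ∧ f ∈ P (d * m) ∧ IsUnit (D f)) :
    (∀ a : ℕ, pNega K P m a = ⊤) ∧ ∀ a : ℕ, 1 ≤ a → Campaign.pnegaGrLit K P m a = ⊥ := by
  have htop : ∀ a : ℕ, pNega K P m a = ⊤ := fun a => by
    obtain ⟨d, k, D, f, had, hdm, hk, hD, hf, hu⟩ := hunit a
    exact pNega_eq_top_of_isUnit_nat K P m a d had hdm hk hD hf hu
  refine ⟨htop, fun a ha => pnegaGrLit_eq_bot_of_eq_top K ?_⟩
  have := htop (a - 1)
  rwa [pNega, show (((a - 1 : ℕ) : ℤ)) = (a : ℤ) - 1 by omega] at this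

end GradedReading

/-! ## 2. The witness `E′ = (y₁² + x·w₁², 2)` over `𝔽₂` (x-chart origin of `E = (y² + x·w², 2)`) -/

section Witness

/-- Frobenius: `g′^{2^k} = y₁^{2^{k+1}} + x^{2^k}·w₁^{2^{k+1}}` in characteristic `2`. [folklore] -/
theorem g_pow_two_pow (k : ℕ) :
    (X 0 ^ 2 + X 1 * X 2 ^ 2 : MvPolynomial (Fin 3) (ZMod 2)) ^ 2 ^ k =
      X 0 ^ 2 ^ (k + 1) + X 1 ^ 2 ^ k * X 2 ^ 2 ^ (k + 1) := by
  rw [add_pow_char_pow, mul_pow, ← pow_mul, ← pow_mul, pow_succ']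

/-- **The lever's unit**: `∂_{y₁}^{(2^{k+1})}(g′^{2^k}) = 1` for every `k ≥ 0` (Hasse–Schmidt derivative
`D^{(2^{k+1} e₀)}`, tree `Resolution.hasseDeriv`). [folklore] -/
theorem hasseDeriv_g_pow (k : ℕ) :
    hasseDeriv (ZMod 2) (Finsupp.single (0 : Fin 3) (2 ^ (k + 1)))
      ((X 0 ^ 2 + X 1 * X 2 ^ 2 : MvPolynomial (Fin 3) (ZMod 2)) ^ 2 ^ k) = 1 := by
  have hsupp : (X 1 ^ 2 ^ k * X 2 ^ 2 ^ (k + 1) : MvPolynomial (Fin 3) (ZMod 2)) ∈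
      supported (ZMod 2) {i : Fin 3 | i ≠ 0} := by
    refine mul_mem (pow_mem ?_ _) (pow_mem ?_ _)
    · exact (X_mem_supported (R := ZMod 2)).mpr (by decide)
    · exact (X_mem_supported (R := ZMod 2)).mpr (by decide)
  have hzero : hasseDeriv (ZMod 2) (Finsupp.single (0 : Fin 3) (2 ^ (k + 1)))
      (X 1 ^ 2 ^ k * X 2 ^ 2 ^ (k + 1) : MvPolynomial (Fin 3) (ZMod 2)) = 0 :=
    hasseDeriv_eq_zero_of_mem_supported (ZMod 2) hsupp (i := 0) (by simp)
      (by rw [Finsupp.single_eq_same]; exact pow_ne_zero _ two_ne_zero)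
  rw [g_pow_two_pow, map_add, hzero, add_zero, hasseDeriv_X_pow, Nat.choose_self, Nat.cast_one, one_mul,
    Nat.sub_self, pow_zero]

/-- (П1)+(П2) give `g′^n ∈ ℘(E′, 2n)` for `n ≥ 1`. [folklore] -/
theorem g_pow_mem (P : ℕ → Ideal (MvPolynomial (Fin 3) (ZMod 2)))
    (h1 : (X 0 ^ 2 + X 1 * X 2 ^ 2 : MvPolynomial (Fin 3) (ZMod 2)) ∈ P 2)
    (h2 : ∀ i j : ℕ, P i * P j ≤ P (i + j)) :
    ∀ n : ℕ, 1 ≤ n → (X 0 ^ 2 + X 1 * X 2 ^ 2 : MvPolynomial (Fin 3) (ZMod 2)) ^ n ∈ P (2 * n)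
  | 0, h => absurd h (by decide)
  | 1, _ => by simpa using h1
  | n + 2, _ => by
    have ih := g_pow_mem P h1 h2 (n + 1) (by omega)
    rw [pow_succ, show 2 * (n + 2) = 2 * (n + 1) + 2 by ring]
    exact h2 _ _ (Ideal.mul_mem_mul ih h1)

/-- **`℘nega(E′,−a)_{ξ′} = (1)` for EVERY `a ≥ 0`** over the typed carrier (`m = 2`) under (П1)+(П2): the summand
`D(2,a,2^a)` of Eq. (36) contains the unit `∂_{y₁}^{(2^{a+1})}(g′^{2^a}) = 1`. [folklore] -/
theorem pNega_witness_eq_top (P : ℕ → Ideal (MvPolynomial (Fin 3) (ZMod 2)))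
    (h1 : (X 0 ^ 2 + X 1 * X 2 ^ 2 : MvPolynomial (Fin 3) (ZMod 2)) ∈ P 2)
    (h2 : ∀ i j : ℕ, P i * P j ≤ P (i + j)) (a : ℕ) : pNega (ZMod 2) P 2 a = ⊤ := by
  have hd : 2 ^ a * 2 = 2 ^ (a + 1) := (pow_succ 2 a).symm
  have hle : a ≤ 2 ^ a * 2 := by
    rw [hd]; exact (Nat.lt_two_pow_self).le.trans (Nat.pow_le_pow_right (by norm_num) (by omega))
  refine pNega_eq_top_of_isUnit_nat (ZMod 2) P 2 a (2 ^ a) hle (by positivity) (k := 2 ^ (a + 1))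
    (by rw [hd])
    (isDiffOpLE_hasseDeriv (ZMod 2) (2 ^ (a + 1)) (Finsupp.single (0 : Fin 3) (2 ^ (a + 1)))
      (by rw [Finsupp.degree_single]))
    (f := (X 0 ^ 2 + X 1 * X 2 ^ 2) ^ 2 ^ a) ?_ ?_
  · rw [hd, show 2 ^ (a + 1) = 2 * 2 ^ a by ring]
    exact g_pow_mem P h1 h2 (2 ^ a) Nat.one_le_two_pow
  · rw [hasseDeriv_g_pow]; exact isUnit_one

/-- Every filtration piece `℘̃(E′,−(a−1))`, `a ≥ 1`, is `(1)` at the witness; for `a = 1` this is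
`℘̃(E′,0) = (1)`. [folklore] -/
theorem pTildeNeg_witness_pred_eq_top (P : ℕ → Ideal (MvPolynomial (Fin 3) (ZMod 2)))
    (h1 : (X 0 ^ 2 + X 1 * X 2 ^ 2 : MvPolynomial (Fin 3) (ZMod 2)) ∈ P 2)
    (h2 : ∀ i j : ℕ, P i * P j ≤ P (i + j)) (a : ℕ) (ha : 1 ≤ a) :
    pTildeNeg (ZMod 2) P 2 ((a : ℤ) - 1) = ⊤ := by
  have := pNega_witness_eq_top P h1 h2 (a - 1)
  rwa [pNega, show (((a - 1 : ℕ) : ℤ)) = (a : ℤ) - 1 by omega] at this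

/-- **All associated-graded negative pieces VANISH at the witness**: `Campaign.pnegaGrLit (ZMod 2) P 2 a = ⊥` for
every `a ≥ 1` (and, in the letters `y, x, w`, the same at `ξ` for `E`). [folklore] -/
theorem pnegaGrLit_witness_eq_bot (P : ℕ → Ideal (MvPolynomial (Fin 3) (ZMod 2)))
    (h1 : (X 0 ^ 2 + X 1 * X 2 ^ 2 : MvPolynomial (Fin 3) (ZMod 2)) ∈ P 2)
    (h2 : ∀ i j : ℕ, P i * P j ≤ P (i + j)) (a : ℕ) (ha : 1 ≤ a) :
    Campaign.pnegaGrLit (ZMod 2) P 2 a = ⊥ :=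
  pnegaGrLit_eq_bot_of_eq_top (ZMod 2) (pTildeNeg_witness_pred_eq_top P h1 h2 a ha)

/-- Under (П3) `℘(E′,j) ⊆ 𝔪^j` (`j ≥ 1`, `𝔪 = (y₁,x,w₁) = idealOfVars`), the piece `℘̃(E′,1) = ⨆_d Diff^{(2d−1)} ℘(E′,2d)`
lies in `𝔪` (`Resolution.diffIdeal_le_pow_sub`). [folklore] -/
theorem pTildeNeg_witness_neg_one_le (P : ℕ → Ideal (MvPolynomial (Fin 3) (ZMod 2)))
    (h3 : ∀ j : ℕ, 1 ≤ j → P j ≤ idealOfVars (Fin 3) (ZMod 2) ^ j) :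
    pTildeNeg (ZMod 2) P 2 (-1) ≤ idealOfVars (Fin 3) (ZMod 2) := by
  unfold pTildeNeg
  refine iSup₂_le fun d hd => ?_
  have hd1 : (1 : ℤ) ≤ d * 2 := by simpa using hd
  obtain ⟨n, rfl⟩ := Int.eq_ofNat_of_zero_le (show (0 : ℤ) ≤ d by omega)
  unfold DD
  have h1 : ((n : ℤ) * ((2 : ℕ) : ℤ) + -1).toNat = 2 * n - 1 := by omega
  have h2 : ((n : ℤ) * ((2 : ℕ) : ℤ)).toNat = 2 * n := by omega
  rw [h1, h2, pPosi_of_ne_zero P (show 2 * n ≠ 0 by omega)]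
  calc diffIdeal (ZMod 2) (2 * n - 1) (P (2 * n))
      ≤ idealOfVars (Fin 3) (ZMod 2) ^ (2 * n - (2 * n - 1)) := diffIdeal_le_pow_sub (ZMod 2) (h3 (2 * n) (by omega)) _
    _ = idealOfVars (Fin 3) (ZMod 2) := by rw [show 2 * n - (2 * n - 1) = 1 by omega, pow_one]

/-- **The unit lands in graded degree `0`** (the lever's mechanism, realised): under (П1)–(П3) the degree-`0` piece
`Campaign.pnegaGrLit (ZMod 2) P 2 0 = ℘̃(E′,0)/℘̃(E′,1)` is NOT `⊥` — it holds the class of `1`. [folklore] -/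
theorem pnegaGrLit_witness_zero_ne_bot (P : ℕ → Ideal (MvPolynomial (Fin 3) (ZMod 2)))
    (h1 : (X 0 ^ 2 + X 1 * X 2 ^ 2 : MvPolynomial (Fin 3) (ZMod 2)) ∈ P 2)
    (h2 : ∀ i j : ℕ, P i * P j ≤ P (i + j)) (h3 : ∀ j : ℕ, 1 ≤ j → P j ≤ idealOfVars (Fin 3) (ZMod 2) ^ j) :
    Campaign.pnegaGrLit (ZMod 2) P 2 0 ≠ ⊥ := by
  rw [Campaign.pnegaGrLit, Ne, grImage_eq_bot_iff, pNega_witness_eq_top P h1 h2 0, top_le_iff,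
    show ((0 : ℕ) : ℤ) - 1 = -1 by norm_num]
  intro h
  have hm : idealOfVars (Fin 3) (ZMod 2) = ⊤ := top_le_iff.mp (h ▸ pTildeNeg_witness_neg_one_le P h3)
  have h1' : (C 1 : MvPolynomial (Fin 3) (ZMod 2)) ∈ idealOfVars (Fin 3) (ZMod 2) ^ 1 := by
    rw [pow_one, hm]; exact Submodule.mem_top
  rw [C_mem_pow_idealOfVars_iff] at h1'
  rcases h1' with h1' | h1' <;> exact one_ne_zero h1'

/-- `g∘π = x²·g′` on the x-chart `y ↦ x·y₁, x ↦ x, w ↦ x·w₁` (`π^*` at ring level, same letters on both sides):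
the total transform of `g = y² + x·w²` is `x²` times `g′ = y₁² + x·w₁²`. [folklore] -/
theorem xChart_g :
    aeval ![X 1 * X 0, X 1, X 1 * X 2] (X 0 ^ 2 + X 1 * X 2 ^ 2 : MvPolynomial (Fin 3) (ZMod 2)) =
      (X 1 ^ 2 * (X 0 ^ 2 + X 1 * X 2 ^ 2) : MvPolynomial (Fin 3) (ZMod 2)) := by
  simp only [map_add, map_mul, map_pow, aeval_X, Matrix.cons_val_zero, Matrix.cons_val_one,
    Matrix.cons_val_two, Matrix.tail_cons, Matrix.head_cons]
  ring

/-- The RIGHT side of Eq. (59) (p.37 l.10–14) at the witness, typed literally at ring level —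
`(∏_i I(D_i,Z_i)^a)(℘nega(E,−a)O_{Z′}) = (x^a) · π^*(℘nega(E,−a))` — is a PROPER ideal for `a ≥ 1`, whatever the
family `P = ℘(E,·)` on `Z` is (everything in it vanishes at `ξ′`). [folklore] -/
theorem rhs59_ne_top (P : ℕ → Ideal (MvPolynomial (Fin 3) (ZMod 2))) (a : ℕ) (ha : 1 ≤ a) :
    Ideal.span {(X 1 : MvPolynomial (Fin 3) (ZMod 2)) ^ a} *
      Ideal.map (aeval ![X 1 * X 0, X 1, X 1 * X 2]) (pNega (ZMod 2) P 2 a) ≠ ⊤ := by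
  intro h
  have hx : Ideal.span {(X 1 : MvPolynomial (Fin 3) (ZMod 2)) ^ a} = ⊤ :=
    top_le_iff.mp (h ▸ Ideal.mul_le_right)
  rw [Ideal.span_singleton_eq_top] at hx
  have hX : IsUnit (X 1 : MvPolynomial (Fin 3) (ZMod 2)) := (isUnit_pow_iff (by omega)).mp hx
  have := hX.map (eval fun _ : Fin 3 => (0 : ZMod 2))
  rw [eval_X] at this
  exact not_isUnit_zero this

/-- **Literal sides of Eq. (59) on the typed carrier differ for every `a ≥ 1`**: LEFT `℘nega(E′,−a)_{ξ′} = (1)`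
under (П1)+(П2) for `E′` (family `P'`), RIGHT proper — for every family `P` on `Z`. (Calibration material for R04 on
OUR decls; no verdict implied.) [folklore] -/
theorem lhs59_ne_rhs59 (P P' : ℕ → Ideal (MvPolynomial (Fin 3) (ZMod 2)))
    (h1 : (X 0 ^ 2 + X 1 * X 2 ^ 2 : MvPolynomial (Fin 3) (ZMod 2)) ∈ P' 2)
    (h2 : ∀ i j : ℕ, P' i * P' j ≤ P' (i + j)) (a : ℕ) (ha : 1 ≤ a) :
    pNega (ZMod 2) P' 2 a ≠ Ideal.span {(X 1 : MvPolynomial (Fin 3) (ZMod 2)) ^ a} *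
      Ideal.map (aeval ![X 1 * X 0, X 1, X 1 * X 2]) (pNega (ZMod 2) P 2 a) := by
  rw [pNega_witness_eq_top P' h1 h2 a]
  exact (rhs59_ne_top P a ha).symm

/-- **Eq. (59) under the graded reading holds at the witness as `⊥ = ⊥`, every `a ≥ 1`**: the left graded side
`Campaign.pnegaGrLit (ZMod 2) P' 2 a` and the graded image of the right side (modulo `℘̃(E′,−(a−1))_{ξ′} = (1)`)
are both the zero module. [folklore] -/
theorem graded59 (P P' : ℕ → Ideal (MvPolynomial (Fin 3) (ZMod 2)))
    (h1 : (X 0 ^ 2 + X 1 * X 2 ^ 2 : MvPolynomial (Fin 3) (ZMod 2)) ∈ P' 2)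
    (h2 : ∀ i j : ℕ, P' i * P' j ≤ P' (i + j)) (a : ℕ) (ha : 1 ≤ a) :
    Campaign.pnegaGrLit (ZMod 2) P' 2 a = ⊥ ∧
      Submodule.map (pTildeNeg (ZMod 2) P' 2 ((a : ℤ) - 1)).mkQ
        (Ideal.span {(X 1 : MvPolynomial (Fin 3) (ZMod 2)) ^ a} *
          Ideal.map (aeval ![X 1 * X 0, X 1, X 1 * X 2]) (pNega (ZMod 2) P 2 a)) = ⊥ :=
  ⟨pnegaGrLit_witness_eq_bot P' h1 h2 a ha,
    grImage_eq_bot_of_eq_top (ZMod 2) (pTildeNeg_witness_pred_eq_top P' h1 h2 a ha) _⟩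

/-- **R08 side (prereg's second check)**: every element `h` of `O_{ξ′}` placed in a negative degree — in particular
the §9.1 knock-out `h = x·w₁²` of `g′` — has graded class `0`, so a graded `T♯ = L0(∞) ∩ ℘nega` / `Cot` (Def 13.2
p.67) receives nothing from the negative part at the witness. [folklore] -/
theorem knockout_grImage_eq_bot (P' : ℕ → Ideal (MvPolynomial (Fin 3) (ZMod 2)))
    (h1 : (X 0 ^ 2 + X 1 * X 2 ^ 2 : MvPolynomial (Fin 3) (ZMod 2)) ∈ P' 2)
    (h2 : ∀ i j : ℕ, P' i * P' j ≤ P' (i + j)) (a : ℕ) (ha : 1 ≤ a) (h : MvPolynomial (Fin 3) (ZMod 2)) :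
    Submodule.map (pTildeNeg (ZMod 2) P' 2 ((a : ℤ) - 1)).mkQ (Ideal.span {h}) = ⊥ :=
  grImage_eq_bot_of_eq_top (ZMod 2) (pTildeNeg_witness_pred_eq_top P' h1 h2 a ha) _

/-- **K1.1 summary at the witness** (prereg clauses): for all `a ≥ 1` the graded sides of (59) agree and are BOTH `⊥`
(criterion DEAD (ii), «degenerate-zero») while the literal sides differ; the class of `1` sits in graded degree `0`
(given (П3)). [folklore] -/
theorem K11_summary (P P' : ℕ → Ideal (MvPolynomial (Fin 3) (ZMod 2)))
    (h1 : (X 0 ^ 2 + X 1 * X 2 ^ 2 : MvPolynomial (Fin 3) (ZMod 2)) ∈ P' 2)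
    (h2 : ∀ i j : ℕ, P' i * P' j ≤ P' (i + j)) (h3 : ∀ j : ℕ, 1 ≤ j → P' j ≤ idealOfVars (Fin 3) (ZMod 2) ^ j) :
    (∀ a : ℕ, 1 ≤ a → Campaign.pnegaGrLit (ZMod 2) P' 2 a = ⊥ ∧
      Submodule.map (pTildeNeg (ZMod 2) P' 2 ((a : ℤ) - 1)).mkQ
        (Ideal.span {(X 1 : MvPolynomial (Fin 3) (ZMod 2)) ^ a} *
          Ideal.map (aeval ![X 1 * X 0, X 1, X 1 * X 2]) (pNega (ZMod 2) P 2 a)) = ⊥) ∧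
    (∀ a : ℕ, 1 ≤ a → pNega (ZMod 2) P' 2 a ≠ Ideal.span {(X 1 : MvPolynomial (Fin 3) (ZMod 2)) ^ a} *
      Ideal.map (aeval ![X 1 * X 0, X 1, X 1 * X 2]) (pNega (ZMod 2) P 2 a)) ∧
    Campaign.pnegaGrLit (ZMod 2) P' 2 0 ≠ ⊥ :=
  ⟨fun a ha => graded59 P P' h1 h2 a ha, fun a ha => lhs59_ne_rhs59 P P' h1 h2 a ha,
    pnegaGrLit_witness_zero_ne_bot P' h1 h2 h3⟩

end Witness

/-! ## 3. Second, Diff-free route: the manuscript's criterion (46) (typed `S06BaseHike.Eq46`, Th 6.3) -/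

section Criterion46

open Literature.AlgebraicGeometry.Hironaka2017.S06BaseHike

variable {O : Type u} [CommRing O] [IsLocalRing O]

omit [IsLocalRing O] in
/-- (П1)+(П2): `g ∈ ℘(E,q)` ⇒ `g^n ∈ ℘(E, q·n)` for `n ≥ 1`. [folklore] -/
theorem pow_mem_of_mul_le (P : ℕ → Ideal O) {q : ℕ} {g : O} (h1 : g ∈ P q)
    (h2 : ∀ i j : ℕ, P i * P j ≤ P (i + j)) : ∀ n : ℕ, 1 ≤ n → g ^ n ∈ P (q * n)
  | 0, h => absurd h (by decide)
  | 1, _ => by simpa using h1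
  | n + 2, _ => by
    have ih := pow_mem_of_mul_le P h1 h2 (n + 1) (by omega)
    rw [pow_succ, show q * (n + 2) = q * (n + 1) + q by ring]
    exact h2 _ _ (Ideal.mul_mem_mul ih h1)

omit [IsLocalRing O] in
/-- **Criterion (46) holds for EVERY `f` in EVERY degree `−a ≤ 0`**: with (П1) `g ∈ ℘(E,q)`, `q > 0`, (П2), Th 4.5
as a HYPOTHESIS (`℘(E,i) ⊆ ℘(E,j)` for `j ≤ i`; typed candidate `S04CharAlgebra.Thm4_5`, not asserted) and `p ≥ 2`:
for `a ≥ 0` and `ℓ ≥ a`, `g^{p^ℓ}·f ∈ ℘(E, q p^ℓ) ⊆ ℘(E, q p^ℓ − a)` — ideal absorption only, no differential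
operator. [folklore] -/
theorem Eq46_of_nonneg (P : ℕ → Ideal O) {p q : ℕ} (hp : 2 ≤ p) (hq : 0 < q) {g : O} (h1 : g ∈ P q)
    (h2 : ∀ i j : ℕ, P i * P j ≤ P (i + j)) (h45 : ∀ i j : ℕ, j ≤ i → P i ≤ P j)
    {a : ℤ} (ha : 0 ≤ a) (f : O) : Eq46 P p q g a f := by
  refine ⟨a.toNat, fun ℓ hℓ => ?_⟩
  have hpl : ℓ < p ^ ℓ := (Nat.lt_two_pow_self).trans_le (Nat.pow_le_pow_left hp ℓ)
  have hqpl : p ^ ℓ ≤ q * p ^ ℓ := Nat.le_mul_of_pos_left _ hq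
  have hal : a ≤ (q * p ^ ℓ : ℕ) := by omega
  refine ⟨hal, ?_⟩
  have hmem : g ^ p ^ ℓ * f ∈ P (q * p ^ ℓ) :=
    Ideal.mul_mem_right f _ (pow_mem_of_mul_le P h1 h2 (p ^ ℓ) (by omega))
  exact h45 (q * p ^ ℓ) _ (by omega) hmem

/-- **IF Th 6.3 describes `℘̃`** (typed candidate `Thm6_3_1 P Pt p q g`, consumed as a hypothesis, never asserted),
then every `℘̃(E,−a)_ξ`, `a ≥ 0`, is `(1)` — criterion (46) holds for `f = 1`. [folklore] -/
theorem pTilde_eq_top_of_Thm6_3_1 (P : ℕ → Ideal O) (Pt : ℤ → Ideal O) {p q : ℕ} {g : O}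
    (h63 : Thm6_3_1 P Pt p q g) (hp : 2 ≤ p) (hq : 0 < q) (h1 : g ∈ P q)
    (hgq : g ∈ IsLocalRing.maximalIdeal O ^ q) (hgq1 : g ∉ IsLocalRing.maximalIdeal O ^ (q + 1))
    (h2 : ∀ i j : ℕ, P i * P j ≤ P (i + j)) (h45 : ∀ i j : ℕ, j ≤ i → P i ≤ P j)
    {a : ℤ} (ha : 0 ≤ a) : Pt (-a) = ⊤ :=
  (Ideal.eq_top_iff_one _).mpr
    ((h63 hq h1 hgq hgq1 a 1 one_ne_zero).mpr (Eq46_of_nonneg P hp hq h1 h2 h45 ha 1))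

/-- Hence, under the same hypotheses, EVERY associated-graded piece of negative degree of `℘̃(E)_ξ` (image of
`Pt (−a)` in `O ⧸ Pt (−(a−1))`, `a ≥ 1`) is `⊥` — the same vanishing by a second mechanism. [folklore] -/
theorem gr_neg_eq_bot_of_Thm6_3_1 (P : ℕ → Ideal O) (Pt : ℤ → Ideal O) {p q : ℕ} {g : O}
    (h63 : Thm6_3_1 P Pt p q g) (hp : 2 ≤ p) (hq : 0 < q) (h1 : g ∈ P q)
    (hgq : g ∈ IsLocalRing.maximalIdeal O ^ q) (hgq1 : g ∉ IsLocalRing.maximalIdeal O ^ (q + 1))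
    (h2 : ∀ i j : ℕ, P i * P j ≤ P (i + j)) (h45 : ∀ i j : ℕ, j ≤ i → P i ≤ P j)
    (a : ℕ) (ha : 1 ≤ a) :
    Submodule.map (Pt (-(((a : ℤ)) - 1))).mkQ (Pt (-(a : ℤ))) = ⊥ := by
  rw [← LinearMap.le_ker_iff_map, Submodule.ker_mkQ,
    pTilde_eq_top_of_Thm6_3_1 P Pt h63 hp hq h1 hgq hgq1 h2 h45 (a := (a : ℤ) - 1) (by omega)]
  exact le_top

end Criterion46

end Summit.ResolutionOfSingularities.ResolutionOfSingularities.Theorems.Campaign.K11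

end
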